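import Mathlib
import Summits.NavierStokesRegularity.NavierStokesRegularity.Theorems.SubOnsagerCeilingKPEntropyProduction
import HarnessLib

/-!
# KP networks proper: the integrated ENTROPY BALANCE and the production socket of the sum-currency route
# (helper file for the crux `SubOnsagerCeiling.ForwardTailCeilingKP`, stmt-NavierStokesRegularity-27057, `--supports`;
# hand leafhand-ns-subonsagerceiling-4 gen 24; def-free; integrated form of `SubOnsagerCeilingKPEntropyProduction`)

Along an honest `ν`-viscous solution of a KP network proper from a one-shell datum (`E_m = Σ_i ½X_{i,m}²`,
`OUT_m = (1+ε₀)^{5m/2} Σ_{i,j} w_{ij} X_{i,m}² X_{j,m+1}`, weights `c : ℕ → ℝ`, power `p ≥ 1`, depth `N`):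

* **`kpProper_entropyPartialSum_balance`** — the integrated production law (FTC on
  `kpProper_entropyPartialSum_hasDerivWithinAt`):
  `Σ_{m≤N} c_m E_m(t)^p − p∫₀ᵗ Σ_{m<N} OUT_m (c_{m+1}E_{m+1}^{p-1} − c_m E_m^{p-1}) + p∫₀ᵗ c_N E_N^{p-1} OUT_N
   + p∫₀ᵗ Σ_{m≤N} 2ν(1+ε₀)^{2m} c_m E_m^p = c_0 · E₀^p` for every `t ∈ [0,s]` (any signs, any `ν`);
* **`kpProper_entropyPartialSum_le_datum_add_production`** — THE PRODUCTION SOCKET (`ν ≥ 0`, `1+ε₀ > 0`, shells `≥ 1`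
  non-negative, weights `≥ 0`): `Σ_{m≤N} c_m E_m(t)^p ≤ c_0 E₀^p + p ∫₀ᵗ Σ_{m<N} OUT_m (c_{m+1}E_{m+1}^{p-1} − c_m E_m^{p-1})`
  — outflow and dissipation only help.  With the entropy weights `c_m = β^m`, `β = ((1+ε₀)^{5/3})^{p-1}`, `p > 5/2`, a
  ν-UNIFORM bound `p∫₀ᵗ(production) ≤ (C − 1)·E₀^p` on the time-integrated bond production (which lives on the INVERTED
  bonds only, `…KPEntropyProduction`) is therefore, by `SubOnsagerCeiling.shellBarrierAt_of_entropyCeiling` (p835561-era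
  transfer file of hand 4-g10), exactly a sufficient condition for the registered `θ_p`-shell barrier of that table.

NOT proved here: any bound on the production integral along actual trajectories (the open dynamics of the stubs
`stub_primaryGradedLargeRatio` / `stub_primaryGradedSmallRatio`).
HONEST FRAMING: statements about Tao-type MODEL lattice ODEs (route SubOnsagerCeiling, rung TL-M2Break); elementary
energy bookkeeping; nothing here bears on Navier–Stokes regularity and no stub, crux or summit is proved.
[cite: Tao2016AveragedNS, §4 (4.6)–(4.9), (4.13)]
-/

noncomputable section

-- the sub-problem namespace `NavierStokesRegularity.NavierStokesRegularity` is the tree's layout (D-0017)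
set_option linter.dupNamespace false

namespace Summit.NavierStokesRegularity.NavierStokesRegularity.Theorems

open Set Finset MeasureTheory intervalIntegral
open scoped Topology
open Literature.Analysis.FluidPDE.TaoCascade

variable {α : Fin 4 → Fin 4 → Fin 4 → ℤ × ℤ × ℤ → ℝ}

/-- The shell energy `E_k(τ) = Σ_i ½X_{i,k}(τ)²` is continuous. [folklore] -/
theorem kpProper_shellEnergy_continuous {X : Fin 4 → ℤ → ℝ → ℝ} (hXc : ∀ (i : Fin 4) (k : ℤ), Continuous (X i k))
    (k : ℤ) : Continuous (fun τ => ∑ i, (1 / 2 : ℝ) * X i k τ ^ 2) :=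
  continuous_finsetSum _ fun i _ => ((hXc i k).pow 2).const_mul _

/-- The entropy production density `Σ_{m<N} OUT_m (c_{m+1}E_{m+1}^{p-1} − c_m E_m^{p-1})` is continuous in time.
[folklore] -/
theorem kpProper_entropyProduction_continuous {ε₀ : ℝ} {X : Fin 4 → ℤ → ℝ → ℝ}
    (hXc : ∀ (i : Fin 4) (k : ℤ), Continuous (X i k)) (c : ℕ → ℝ) (q N : ℕ) :
    Continuous (fun τ => ∑ m ∈ Finset.range N,
      ((1 + ε₀) ^ ((5 : ℝ) * (m : ℝ) / 2) *
          ∑ i, ∑ j, α i i j (0, 0, 1) * X i (m : ℤ) τ ^ 2 * X j ((m : ℤ) + 1) τ) *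
        (c (m + 1) * (∑ i, (1 / 2 : ℝ) * X i ((m : ℤ) + 1) τ ^ 2) ^ q -
          c m * (∑ i, (1 / 2 : ℝ) * X i (m : ℤ) τ ^ 2) ^ q)) := by
  refine continuous_finsetSum _ fun m _ => (kpProper_outFlux_continuous hXc m).mul ?_
  exact (continuous_const.mul ((kpProper_shellEnergy_continuous hXc _).pow q)).sub
    (continuous_const.mul ((kpProper_shellEnergy_continuous hXc _).pow q))

/-- The top-bond outflow density `c_N E_N^{p-1} OUT_N` is continuous in time. [folklore] -/
theorem kpProper_entropyOutflow_continuous {ε₀ : ℝ} {X : Fin 4 → ℤ → ℝ → ℝ}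
    (hXc : ∀ (i : Fin 4) (k : ℤ), Continuous (X i k)) (c : ℕ → ℝ) (q N : ℕ) :
    Continuous (fun τ => (c N * (∑ i, (1 / 2 : ℝ) * X i (N : ℤ) τ ^ 2) ^ q) *
      ((1 + ε₀) ^ ((5 : ℝ) * (N : ℝ) / 2) *
        ∑ i, ∑ j, α i i j (0, 0, 1) * X i (N : ℤ) τ ^ 2 * X j ((N : ℤ) + 1) τ)) :=
  (continuous_const.mul ((kpProper_shellEnergy_continuous hXc _).pow q)).mul (kpProper_outFlux_continuous hXc N)

/-- The weighted entropy dissipation density `Σ_{m≤N} 2ν(1+ε₀)^{2m} c_m E_m^p` is continuous in time. [folklore] -/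
theorem kpProper_entropyDissipation_continuous {ε₀ ν : ℝ} {X : Fin 4 → ℤ → ℝ → ℝ}
    (hXc : ∀ (i : Fin 4) (k : ℤ), Continuous (X i k)) (c : ℕ → ℝ) (p N : ℕ) :
    Continuous (fun τ => ∑ m ∈ Finset.range (N + 1),
      2 * (ν * (1 + ε₀) ^ ((2 : ℝ) * (m : ℝ))) * (c m * (∑ i, (1 / 2 : ℝ) * X i (m : ℤ) τ ^ 2) ^ p)) :=
  continuous_finsetSum _ fun m _ =>
    continuous_const.mul (continuous_const.mul ((kpProper_shellEnergy_continuous hXc (m : ℤ)).pow p))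

/-- **THE INTEGRATED ENTROPY BALANCE OF A KP NETWORK PROPER.**  Along an honest `ν`-viscous solution from a
one-shell datum `X₀` on shell `0` (no negative shells, continuous modes, exact viscous equation within `[0,s]`), for
all weights `c`, powers `p ≥ 1`, depths `N` and `t ∈ [0,s]`:
`Σ_{m≤N} c_m E_m(t)^p − p∫₀ᵗ(production) + p∫₀ᵗ(top outflow) + p∫₀ᵗ(dissipation) = c_0 · E₀^p`.
MODEL lattice statement. [cite: Tao2016AveragedNS, §4 (4.6)–(4.9), (4.13)] -/
theorem kpProper_entropyPartialSum_balance (hs : IsSymmetricCoeff α) (hc : IsCancellingCoeff α)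
    (hO : ∀ (Y : Fin 4 → ℤ → ℝ → ℝ) (τ : ℝ), (∀ (j : Fin 4) (k : ℤ), 1 ≤ k → 0 ≤ Y j k τ) →
      ∀ δ : ℝ, 0 < δ → ∀ (i : Fin 4) (n : ℤ), 1 ≤ n → Y i n τ = 0 → 0 ≤ quadTerm δ α Y i n τ)
    (hD : ∀ a b i : Fin 4, a ≠ b → α a b i (0, 0, 1) = 0)
    {ε₀ ν s : ℝ} {X₀ : Fin 4 → ℝ} {X : Fin 4 → ℤ → ℝ → ℝ}
    (hdat : ∀ (i : Fin 4) (k : ℤ), X i k 0 = if k = 0 then X₀ i else 0)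
    (hvan : ∀ (i : Fin 4) (k : ℤ), k < 0 → ∀ t : ℝ, X i k t = 0)
    (hXc : ∀ (i : Fin 4) (k : ℤ), Continuous (X i k))
    (hode : ∀ (i : Fin 4) (k : ℤ), ∀ t ∈ Icc (0 : ℝ) s, HasDerivWithinAt (X i k)
      (quadTerm ε₀ α X i k t - ν * (1 + ε₀) ^ ((2 : ℝ) * k) * X i k t) (Icc (0 : ℝ) s) t)
    (c : ℕ → ℝ) {p : ℕ} (hp : 1 ≤ p) (N : ℕ) :
    ∀ t ∈ Icc (0 : ℝ) s,
      ∑ m ∈ Finset.range (N + 1), c m * (∑ i, (1 / 2 : ℝ) * X i (m : ℤ) t ^ 2) ^ p -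
        (p : ℝ) * (∫ τ in (0 : ℝ)..t, ∑ m ∈ Finset.range N,
          ((1 + ε₀) ^ ((5 : ℝ) * (m : ℝ) / 2) *
              ∑ i, ∑ j, α i i j (0, 0, 1) * X i (m : ℤ) τ ^ 2 * X j ((m : ℤ) + 1) τ) *
            (c (m + 1) * (∑ i, (1 / 2 : ℝ) * X i ((m : ℤ) + 1) τ ^ 2) ^ (p - 1) -
              c m * (∑ i, (1 / 2 : ℝ) * X i (m : ℤ) τ ^ 2) ^ (p - 1))) +
        (p : ℝ) * (∫ τ in (0 : ℝ)..t, (c N * (∑ i, (1 / 2 : ℝ) * X i (N : ℤ) τ ^ 2) ^ (p - 1)) *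
          ((1 + ε₀) ^ ((5 : ℝ) * (N : ℝ) / 2) *
            ∑ i, ∑ j, α i i j (0, 0, 1) * X i (N : ℤ) τ ^ 2 * X j ((N : ℤ) + 1) τ)) +
        (p : ℝ) * (∫ τ in (0 : ℝ)..t, ∑ m ∈ Finset.range (N + 1),
          2 * (ν * (1 + ε₀) ^ ((2 : ℝ) * (m : ℝ))) * (c m * (∑ i, (1 / 2 : ℝ) * X i (m : ℤ) τ ^ 2) ^ p)) =
        c 0 * (∑ i, (1 / 2 : ℝ) * X₀ i ^ 2) ^ p := by
  set S : ℝ → ℝ := fun τ => ∑ m ∈ Finset.range (N + 1), c m * (∑ i, (1 / 2 : ℝ) * X i (m : ℤ) τ ^ 2) ^ p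
    with hS
  set PROD : ℝ → ℝ := fun τ => ∑ m ∈ Finset.range N,
      ((1 + ε₀) ^ ((5 : ℝ) * (m : ℝ) / 2) *
          ∑ i, ∑ j, α i i j (0, 0, 1) * X i (m : ℤ) τ ^ 2 * X j ((m : ℤ) + 1) τ) *
        (c (m + 1) * (∑ i, (1 / 2 : ℝ) * X i ((m : ℤ) + 1) τ ^ 2) ^ (p - 1) -
          c m * (∑ i, (1 / 2 : ℝ) * X i (m : ℤ) τ ^ 2) ^ (p - 1)) with hPROD
  set TOP : ℝ → ℝ := fun τ => (c N * (∑ i, (1 / 2 : ℝ) * X i (N : ℤ) τ ^ 2) ^ (p - 1)) *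
      ((1 + ε₀) ^ ((5 : ℝ) * (N : ℝ) / 2) *
        ∑ i, ∑ j, α i i j (0, 0, 1) * X i (N : ℤ) τ ^ 2 * X j ((N : ℤ) + 1) τ) with hTOP
  set DISS : ℝ → ℝ := fun τ => ∑ m ∈ Finset.range (N + 1),
      2 * (ν * (1 + ε₀) ^ ((2 : ℝ) * (m : ℝ))) * (c m * (∑ i, (1 / 2 : ℝ) * X i (m : ℤ) τ ^ 2) ^ p)
    with hDISS
  have hPRODc : Continuous PROD := kpProper_entropyProduction_continuous hXc c (p - 1) N
  have hTOPc : Continuous TOP := kpProper_entropyOutflow_continuous hXc c (p - 1) N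
  have hDISSc : Continuous DISS := kpProper_entropyDissipation_continuous hXc c p N
  have hSc : Continuous S := continuous_finsetSum _ fun m _ =>
    continuous_const.mul ((kpProper_shellEnergy_continuous hXc _).pow p)
  -- the balance function and its (vanishing) derivative
  set G : ℝ → ℝ := fun τ => S τ - (p : ℝ) * (∫ x in (0 : ℝ)..τ, PROD x) + (p : ℝ) * (∫ x in (0 : ℝ)..τ, TOP x) +
    (p : ℝ) * ∫ x in (0 : ℝ)..τ, DISS x with hG
  have hGc : ContinuousOn G (Icc 0 s) := by
    refine Continuous.continuousOn ?_
    refine ((hSc.sub (continuous_const.mul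
      (intervalIntegral.continuous_primitive (fun a b => hPRODc.intervalIntegrable a b) 0))).add
      (continuous_const.mul
        (intervalIntegral.continuous_primitive (fun a b => hTOPc.intervalIntegrable a b) 0))).add
      (continuous_const.mul
        (intervalIntegral.continuous_primitive (fun a b => hDISSc.intervalIntegrable a b) 0))
  have hGd : ∀ τ ∈ Icc (0 : ℝ) s, HasDerivWithinAt G 0 (Icc 0 s) τ := by
    intro τ hτ
    have h1 := kpProper_entropyPartialSum_hasDerivWithinAt hs hc hO hD hvan hode c hp N hτ
    have h2 : HasDerivWithinAt (fun u => ∫ x in (0 : ℝ)..u, PROD x) (PROD τ) (Icc 0 s) τ :=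
      (intervalIntegral.integral_hasDerivAt_right (hPRODc.intervalIntegrable _ _)
        (hPRODc.stronglyMeasurableAtFilter _ _) hPRODc.continuousAt).hasDerivWithinAt
    have h3 : HasDerivWithinAt (fun u => ∫ x in (0 : ℝ)..u, TOP x) (TOP τ) (Icc 0 s) τ :=
      (intervalIntegral.integral_hasDerivAt_right (hTOPc.intervalIntegrable _ _)
        (hTOPc.stronglyMeasurableAtFilter _ _) hTOPc.continuousAt).hasDerivWithinAt
    have h4 : HasDerivWithinAt (fun u => ∫ x in (0 : ℝ)..u, DISS x) (DISS τ) (Icc 0 s) τ :=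
      (intervalIntegral.integral_hasDerivAt_right (hDISSc.intervalIntegrable _ _)
        (hDISSc.stronglyMeasurableAtFilter _ _) hDISSc.continuousAt).hasDerivWithinAt
    have h := ((h1.sub (h2.const_mul (p : ℝ))).add (h3.const_mul (p : ℝ))).add (h4.const_mul (p : ℝ))
    refine h.congr_deriv ?_
    simp only [hPROD, hTOP, hDISS]
    ring
  -- a function with vanishing right derivative on `[0,s]` is constant
  have hGd' : ∀ u ∈ Ico (0 : ℝ) s, HasDerivWithinAt G 0 (Ici u) u := fun u hu =>
    (hGd u (Ico_subset_Icc_self hu)).mono_of_mem_nhdsWithin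
      (Filter.mem_of_superset (Icc_mem_nhdsGE hu.2) (Icc_subset_Icc hu.1 le_rfl))
  have hG0 : G 0 = c 0 * (∑ i, (1 / 2 : ℝ) * X₀ i ^ 2) ^ p := by
    simp only [hG, hS, intervalIntegral.integral_same, mul_zero, sub_zero, add_zero]
    exact kpProper_entropyPartialSum_datum hdat c hp N
  intro t ht
  have h := constant_of_has_deriv_right_zero hGc hGd' t ht
  rw [hG0] at h
  exact h

/-- **THE PRODUCTION SOCKET OF THE SUM-CURRENCY ROUTE.**  Along an honest non-negative `ν`-viscous solution
(`ν ≥ 0`, `1 + ε₀ > 0`, shells `≥ 1` non-negative) of a KP network proper from a one-shell datum, with weights `c_m ≥ 0`: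
`Σ_{m≤N} c_m E_m(t)^p ≤ c_0 · E₀^p + p ∫₀ᵗ Σ_{m<N} OUT_m (c_{m+1}E_{m+1}^{p-1} − c_m E_m^{p-1})` for every `t ∈ [0,s]`
(the top outflow and the dissipation are `≥ 0` and dropped).  Hence a ν-uniform bound on the time-integrated bond
production is an entropy ceiling, i.e. (for `p > 5/2`, entropy weights) the registered `θ_p`-shell barrier.
MODEL lattice statement. [cite: Tao2016AveragedNS, §4 (4.6)–(4.9), (4.13)] -/
theorem kpProper_entropyPartialSum_le_datum_add_production (hs : IsSymmetricCoeff α) (hc : IsCancellingCoeff α)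
    (hO : ∀ (Y : Fin 4 → ℤ → ℝ → ℝ) (τ : ℝ), (∀ (j : Fin 4) (k : ℤ), 1 ≤ k → 0 ≤ Y j k τ) →
      ∀ δ : ℝ, 0 < δ → ∀ (i : Fin 4) (n : ℤ), 1 ≤ n → Y i n τ = 0 → 0 ≤ quadTerm δ α Y i n τ)
    (hD : ∀ a b i : Fin 4, a ≠ b → α a b i (0, 0, 1) = 0)
    {ε₀ ν s : ℝ} (hε : 0 < 1 + ε₀) (hν : 0 ≤ ν) {X₀ : Fin 4 → ℝ} {X : Fin 4 → ℤ → ℝ → ℝ}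
    (hdat : ∀ (i : Fin 4) (k : ℤ), X i k 0 = if k = 0 then X₀ i else 0)
    (hvan : ∀ (i : Fin 4) (k : ℤ), k < 0 → ∀ t : ℝ, X i k t = 0)
    (hXc : ∀ (i : Fin 4) (k : ℤ), Continuous (X i k))
    (hode : ∀ (i : Fin 4) (k : ℤ), ∀ t ∈ Icc (0 : ℝ) s, HasDerivWithinAt (X i k)
      (quadTerm ε₀ α X i k t - ν * (1 + ε₀) ^ ((2 : ℝ) * k) * X i k t) (Icc (0 : ℝ) s) t)
    (hnn : ∀ t ∈ Icc (0 : ℝ) s, ∀ (i : Fin 4) (k : ℤ), 1 ≤ k → 0 ≤ X i k t)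
    {c : ℕ → ℝ} (hcw : ∀ m, 0 ≤ c m) {p : ℕ} (hp : 1 ≤ p) (N : ℕ) :
    ∀ t ∈ Icc (0 : ℝ) s,
      ∑ m ∈ Finset.range (N + 1), c m * (∑ i, (1 / 2 : ℝ) * X i (m : ℤ) t ^ 2) ^ p ≤
        c 0 * (∑ i, (1 / 2 : ℝ) * X₀ i ^ 2) ^ p +
          (p : ℝ) * ∫ τ in (0 : ℝ)..t, ∑ m ∈ Finset.range N,
            ((1 + ε₀) ^ ((5 : ℝ) * (m : ℝ) / 2) *
                ∑ i, ∑ j, α i i j (0, 0, 1) * X i (m : ℤ) τ ^ 2 * X j ((m : ℤ) + 1) τ) *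
              (c (m + 1) * (∑ i, (1 / 2 : ℝ) * X i ((m : ℤ) + 1) τ ^ 2) ^ (p - 1) -
                c m * (∑ i, (1 / 2 : ℝ) * X i (m : ℤ) τ ^ 2) ^ (p - 1)) := by
  intro t ht
  have hbal := kpProper_entropyPartialSum_balance hs hc hO hD hdat hvan hXc hode c hp N t ht
  have hp0 : (0 : ℝ) ≤ (p : ℝ) := Nat.cast_nonneg p
  -- out-fluxes and shell energies are non-negative on the window
  have hOUT : ∀ τ ∈ Icc (0 : ℝ) s, ∀ m : ℕ, 0 ≤ (1 + ε₀) ^ ((5 : ℝ) * (m : ℝ) / 2) *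
      ∑ i, ∑ j, α i i j (0, 0, 1) * X i (m : ℤ) τ ^ 2 * X j ((m : ℤ) + 1) τ := by
    intro τ hτ m
    refine mul_nonneg (Real.rpow_pos_of_pos hε _).le (Finset.sum_nonneg fun i _ =>
      Finset.sum_nonneg fun j _ => ?_)
    exact mul_nonneg (mul_nonneg (kpProper_feed_nonneg hO i j) (sq_nonneg _)) (hnn τ hτ j _ (by omega))
  have hEnn : ∀ (τ : ℝ) (k : ℤ), 0 ≤ ∑ i, (1 / 2 : ℝ) * X i k τ ^ 2 := fun τ k =>
    Finset.sum_nonneg fun i _ => by positivity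
  have hTOP : 0 ≤ (p : ℝ) * ∫ τ in (0 : ℝ)..t, (c N * (∑ i, (1 / 2 : ℝ) * X i (N : ℤ) τ ^ 2) ^ (p - 1)) *
      ((1 + ε₀) ^ ((5 : ℝ) * (N : ℝ) / 2) *
        ∑ i, ∑ j, α i i j (0, 0, 1) * X i (N : ℤ) τ ^ 2 * X j ((N : ℤ) + 1) τ) := by
    refine mul_nonneg hp0 (intervalIntegral.integral_nonneg ht.1 fun τ hτ => ?_)
    exact mul_nonneg (mul_nonneg (hcw N) (pow_nonneg (hEnn τ _) _)) (hOUT τ ⟨hτ.1, hτ.2.trans ht.2⟩ N)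
  have hDISS : 0 ≤ (p : ℝ) * ∫ τ in (0 : ℝ)..t, ∑ m ∈ Finset.range (N + 1),
      2 * (ν * (1 + ε₀) ^ ((2 : ℝ) * (m : ℝ))) * (c m * (∑ i, (1 / 2 : ℝ) * X i (m : ℤ) τ ^ 2) ^ p) := by
    refine mul_nonneg hp0 (intervalIntegral.integral_nonneg ht.1 fun τ _ => Finset.sum_nonneg fun m _ => ?_)
    exact mul_nonneg (mul_nonneg (by norm_num) (mul_nonneg hν (Real.rpow_pos_of_pos hε _).le))
      (mul_nonneg (hcw m) (pow_nonneg (hEnn τ _) _))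
  linarith

end Summit.NavierStokesRegularity.NavierStokesRegularity.Theorems

end
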